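import Summits.QuantumFields.YangMills.Theorems.UnitScaleTiltProp7LODCutoffLetters
import HarnessLib

/-!
# Route `UnitScaleTilt`, crux K1 «MinimiserStabilityRegPr» (stmt-QuantumFields-19200), EX row `hGF` (curved member), the LOD line — **PEN (L6-χ), FILE E = SLOT (K2a): THE FAMILY
# (`Σ_c`) EDITION OF THE ZEROTH-ORDER COMMUTATOR ROWS OF `D_W`, `D*_W` WITH A QUADRATIC PARTITION — VOLUME-FREE.**  `Σ_c ‖D*_W(χ_c(b₋)•X)~ − (χ_c•D*_WX̃)~‖² ≤ 3·B·η⁻²·‖X̃‖²`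
# and the `D`-twin, `B` the per-fine-step FAMILY row `Σ_c (χ_c(x + e_μ) − χ_c(x))² ≤ B` (✓`exists_sqPartition`: `B = 2880∕(L^sL^{K−n})²`, so `3Bη⁻² = 8640·L^{−2s}`).

Cell `ym3-torus` (HUMAN RULING D-0037: YM₃ on T³ is ladder rung R3 — NOT d = 4, NOT infinite volume, NOT a mass gap, NOT Clay).  Width seat `ym3-torus-px17` (gen 8); px10 g10
located the slot («(K2a)», 2026-08-30 01:16Z: the per-centre rows of FILE B ✓p753060 carry the GLOBAL `‖f‖²`, so their `Σ_c` is volume-dependent; w5 g13's knit binder `hKD`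
wants the family budget).  THEOREMS ONLY (0 `def`, 0 `sorry`); `--supports stmt-QuantumFields-19200 --as helper`, count-neutral.  HONEST LABEL (№33 (6)): stencil bookkeeping;
no estimate of Bałaban's; nothing of `hK₂`, (L6), `hGF`, `h349`, EX or the crux is proved here.

THE MATHEMATICS (print (3.3), (3.8) p. 391–392).  `D`: ✓`norm_sq_DL2_smul_sub_eq` gives `‖[D_W, χ_c]λ̃‖² = c₀η⁻²Σ_b (χ_c(b₊) − χ_c(b₋))²hs(λ b₊)` EXACTLY; swap `Σ_c Σ_b`, bound
`Σ_c (χ_c(b₊) − χ_c(b₋))² ≤ B` bondwise (`b₊ = b₋ + e_{μ(b)}`), re-index by targets (`Σ_b hs(λ b₊) = 3·Σ_x hs(λ x)`).  `D*`: ✓`toL2S_symm_DstarL2_srcMul_sub_apply` reads the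
commutator at a site as `η⁻¹Σ_μ w_{c,μ}(x)•Ad(W⁻¹)X(b_μ)`, `w_{c,μ}(x) = χ_c(x − e_μ) − χ_c(x)`; Cauchy–Schwarz over `μ` with SQUARED weights `hs(Σ_μ w_μ•M_μ) ≤ (Σ_μ w_μ²)·Σ_μ hs(M_μ)`,
then `Σ_c Σ_μ w_{c,μ}(x)² ≤ 3B` (the family row at `x − e_μ` along `μ`), unitarity drops `Ad`, and each bond is met once at its target.

WHAT IS PROVED (ns `…Theorems.Prop7CutoffCommutatorFamily`): §0 `normSq_sum_smul_le_sq` (entrywise CS with squared real weights); §1 ★★`sum_normSq_DL2_siteMul_sub_le`;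
§2 ★★`sum_normSq_DstarL2_srcMul_sub_le`; §3 ★★★`sum_normSq_comm_rows_of_readings` (operator form for ANY families `Zs c, Zb c` with the (Z2) readings); §4 ★★★ the rows at the
(χ)-dock's letters: `sum_normSq_Dstar_comm_le_of_dock`, `sum_normSq_D_comm_le_of_dock` — `Σ_{c : Site (F.P K) 0} ‖D*_{W}(M c f) − N₂ c (D*_W f)‖² ≤ 8640·((L^s)²)⁻¹·‖f‖²` (+ `D`-twin)
from the clauses of ✓`Prop7LODCutoffDock.exists_LOD_cutoffs` (zero off `Zc`, `hfam`, readings) — w5's `hKD` with `κD² = 8640∕L^{2s}`, K- and volume-free.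

References: T. Bałaban, CMP **99** (1985) 389–434 [Balaban1985BackgroundPropagators] ((3.3) p.391, (3.8) p.392, (3.100) pp.413–414); CMP **98** (1985) 17–51 [Balaban1985Averaging] ((5) p.18).
-/

set_option autoImplicit false

noncomputable section

open scoped BigOperators Matrix.Norms.L2Operator Matrix

namespace Summit.QuantumFields.YangMills.Theorems.Prop7CutoffCommutatorFamily

open Literature.MathematicalPhysics.QuantumFieldTheory.Balaban1983to89
open Literature.MathematicalPhysics.QuantumFieldTheory.Balaban1983to89.T3ContinuumYM3Torus
open T3SectALandauChart (bgUnits eta eta_pos)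
open B10StarCount (shift_unshift unshift_shift)
open B9Eq39Adjoint (R)
open B11Eq103H1Complex (SiteL2K BondL2K)
open Summit.QuantumFields.YangMills.Theorems.Prop7SectET3Transport (periodsT3)
open Summit.QuantumFields.YangMills.Theorems.Prop7SectET3HilbertLetters (W₂ toL2 toL2S DL2 DstarL2)
open Summit.QuantumFields.YangMills.Theorems.Prop7LaplaceAFlatLetters (norm_sq_toL2 norm_sq_toL2S)
open Summit.QuantumFields.YangMills.Theorems.Prop7CovariantCoercivity (sum_norm_sq_R inv_mem_unitary)
open Summit.QuantumFields.YangMills.Theorems.Prop7CovAgmonLetters (hs_smul)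
open Summit.QuantumFields.YangMills.Theorems.Prop7Lane2CutoffCommutators (coe_bgUnits_mem_unitary' norm_sq_DL2_smul_sub_eq sum_pbond_tgt)
open Summit.QuantumFields.YangMills.Theorems.Prop7LODCutoffLetters (sum_unshift_eq_sum_bond toL2S_symm_DstarL2_srcMul_sub_apply)

/-! ## §0 Cauchy–Schwarz with squared real weights -/

/-- `hs(Σ_μ w_μ • M_μ) ≤ (Σ_μ w_μ²)·Σ_μ hs(M_μ)` (entry by entry). [folklore] -/
theorem normSq_sum_smul_le_sq {ι : Type*} (s : Finset ι) {N : ℕ} (w : ι → ℝ) (M : ι → Matrix (Fin N) (Fin N) ℂ) :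
    ∑ j : Fin N, ∑ k : Fin N, ‖(∑ μ ∈ s, w μ • M μ) j k‖ ^ 2 ≤ (∑ μ ∈ s, w μ ^ 2) * ∑ μ ∈ s, ∑ j : Fin N, ∑ k : Fin N, ‖M μ j k‖ ^ 2 := by
  have hjk : ∀ j k, ‖(∑ μ ∈ s, w μ • M μ) j k‖ ^ 2 ≤ (∑ μ ∈ s, w μ ^ 2) * ∑ μ ∈ s, ‖M μ j k‖ ^ 2 := by
    intro j k
    rw [Matrix.sum_apply]
    have h1 : ‖∑ μ ∈ s, (w μ • M μ) j k‖ ≤ ∑ μ ∈ s, |w μ| * ‖M μ j k‖ := by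
      refine (norm_sum_le _ _).trans (Finset.sum_le_sum fun μ _ => ?_)
      rw [Matrix.smul_apply, norm_smul, Real.norm_eq_abs]
    have h2 : (∑ μ ∈ s, |w μ| * ‖M μ j k‖) ^ 2 ≤ (∑ μ ∈ s, |w μ| ^ 2) * ∑ μ ∈ s, ‖M μ j k‖ ^ 2 :=
      Finset.sum_mul_sq_le_sq_mul_sq s (fun μ => |w μ|) (fun μ => ‖M μ j k‖)
    simp only [sq_abs] at h2
    have h0 : 0 ≤ ‖∑ μ ∈ s, (w μ • M μ) j k‖ := norm_nonneg _
    nlinarith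
  calc ∑ j : Fin N, ∑ k : Fin N, ‖(∑ μ ∈ s, w μ • M μ) j k‖ ^ 2
      ≤ ∑ j : Fin N, ∑ k : Fin N, (∑ μ ∈ s, w μ ^ 2) * ∑ μ ∈ s, ‖M μ j k‖ ^ 2 :=
        Finset.sum_le_sum fun j _ => Finset.sum_le_sum fun k _ => hjk j k
    _ = (∑ μ ∈ s, w μ ^ 2) * ∑ j : Fin N, ∑ k : Fin N, ∑ μ ∈ s, ‖M μ j k‖ ^ 2 := by
        rw [Finset.mul_sum]
        refine Finset.sum_congr rfl fun j _ => ?_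
        rw [Finset.mul_sum]
    _ = (∑ μ ∈ s, w μ ^ 2) * ∑ μ ∈ s, ∑ j : Fin N, ∑ k : Fin N, ‖M μ j k‖ ^ 2 := by
        congr 1
        calc ∑ j : Fin N, ∑ k : Fin N, ∑ μ ∈ s, ‖M μ j k‖ ^ 2
            = ∑ j : Fin N, ∑ μ ∈ s, ∑ k : Fin N, ‖M μ j k‖ ^ 2 := Finset.sum_congr rfl fun j _ => Finset.sum_comm
          _ = ∑ μ ∈ s, ∑ j : Fin N, ∑ k : Fin N, ‖M μ j k‖ ^ 2 := Finset.sum_comm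

section Member

variable (F : T3Family) {n K : ℕ} {c₀ : ℝ} [Fact (0 < c₀)] {ι : Type*} (s : Finset ι)

/-! ## §1 The `D`-row, family edition -/

/-- ★★ **`Σ_c ‖D_W(χ_c•λ)~ − (χ_c(b₋)•D_Wλ̃)~‖² ≤ 3·B·η⁻²·‖λ̃‖²`** from the family per-step row `Σ_c (χ_c(x+e_μ) − χ_c x)² ≤ B`.
[cite: Balaban1985BackgroundPropagators, (3.3) p.391, (3.100) pp.413-414] -/
theorem sum_normSq_DL2_siteMul_sub_le (W : GaugeField (F.P K) 0 (Matrix.specialUnitaryGroup (Fin 2) ℂ)) (χ : ι → Site (F.P K) 0 → ℝ) {B : ℝ}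
    (hfam : ∀ (x : Site (F.P K) 0) (μ : Fin (F.P K).d), ∑ c ∈ s, (χ c (x.shift μ) - χ c x) ^ 2 ≤ B)
    (l : Site (F.P K) 0 → Matrix (Fin 2) (Fin 2) ℂ) :
    ∑ c ∈ s, ‖DL2 F n K c₀ W (toL2S F K c₀ (fun x => χ c x • l x))
        - toL2 F K c₀ (fun b => χ c b.src • (toL2 F K c₀).symm (DL2 F n K c₀ W (toL2S F K c₀ l)) b)‖ ^ 2
      ≤ 3 * B * (eta F n K)⁻¹ ^ 2 * ‖toL2S F K c₀ l‖ ^ 2 := by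
  have hc : 0 < c₀ := Fact.out
  rw [Finset.sum_congr rfl fun c _ => norm_sq_DL2_smul_sub_eq F n K c₀ W (χ c) l, ← Finset.mul_sum, Finset.sum_comm]
  -- bondwise: `Σ_c (χ_c(b₊) − χ_c(b₋))² ≤ B`
  have hbond : ∀ b : PBond (F.P K) 0, ∑ c ∈ s, (χ c b.tgt - χ c b.src) ^ 2 * ∑ j : Fin 2, ∑ k : Fin 2, ‖l b.tgt j k‖ ^ 2
      ≤ B * ∑ j : Fin 2, ∑ k : Fin 2, ‖l b.tgt j k‖ ^ 2 := by
    intro b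
    rw [← Finset.sum_mul]
    exact mul_le_mul_of_nonneg_right (hfam b.src b.dir) (Finset.sum_nonneg fun _ _ => Finset.sum_nonneg fun _ _ => sq_nonneg _)
  have hsum : ∑ b : PBond (F.P K) 0, B * ∑ j : Fin 2, ∑ k : Fin 2, ‖l b.tgt j k‖ ^ 2 = B * (3 * ∑ x : Site (F.P K) 0, ∑ j : Fin 2, ∑ k : Fin 2, ‖l x j k‖ ^ 2) := by
    rw [← Finset.mul_sum, sum_pbond_tgt F K (fun _ x => ∑ j : Fin 2, ∑ k : Fin 2, ‖l x j k‖ ^ 2), Finset.sum_const, Finset.card_univ, Fintype.card_fin, nsmul_eq_mul,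
      Nat.cast_ofNat]
  have h1 := (Finset.sum_le_sum fun b (_ : b ∈ Finset.univ) => hbond b).trans_eq hsum
  rw [norm_sq_toL2S]
  have hη : 0 ≤ c₀ * (eta F n K)⁻¹ ^ 2 := by positivity
  calc c₀ * (eta F n K)⁻¹ ^ 2 * ∑ b : PBond (F.P K) 0, ∑ c ∈ s, (χ c b.tgt - χ c b.src) ^ 2 * ∑ j : Fin 2, ∑ k : Fin 2, ‖l b.tgt j k‖ ^ 2
      ≤ c₀ * (eta F n K)⁻¹ ^ 2 * (B * (3 * ∑ x : Site (F.P K) 0, ∑ j : Fin 2, ∑ k : Fin 2, ‖l x j k‖ ^ 2)) := mul_le_mul_of_nonneg_left h1 hη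
    _ = 3 * B * (eta F n K)⁻¹ ^ 2 * (c₀ * ∑ x : Site (F.P K) 0, ∑ j : Fin 2, ∑ k : Fin 2, ‖l x j k‖ ^ 2) := by ring

/-! ## §2 The `D*`-row, family edition -/

/-- Real-arithmetic closer of the next proof. [folklore] -/
theorem chain_le_of_rows' {L c Sg e ST B SX : ℝ} (hc : 0 ≤ c) (he : 0 ≤ e) (h1 : L = c * Sg) (h2 : Sg ≤ e * ST) (h3 : ST ≤ 3 * B * SX) :
    L ≤ 3 * B * e * (c * SX) := by
  rw [h1]
  have h4 : c * Sg ≤ c * (e * (3 * B * SX)) := mul_le_mul_of_nonneg_left (h2.trans (mul_le_mul_of_nonneg_left h3 he)) hc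
  calc c * Sg ≤ c * (e * (3 * B * SX)) := h4
    _ = 3 * B * e * (c * SX) := by ring

/-- ★★ **`Σ_c ‖D*_W(χ_c(b₋)•X)~ − (χ_c•D*_WX̃)~‖² ≤ 3·B·η⁻²·‖X̃‖²** from the family per-step row (each bond met once at its target; `Ad` unitary; Cauchy–Schwarz over the
`3` directions with squared weights, then the family row at `x − e_μ` along `μ`). [cite: Balaban1985BackgroundPropagators, (3.8) p.392, (3.100) pp.413-414] -/
theorem sum_normSq_DstarL2_srcMul_sub_le (W : GaugeField (F.P K) 0 (Matrix.specialUnitaryGroup (Fin 2) ℂ)) (χ : ι → Site (F.P K) 0 → ℝ) {B : ℝ}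
    (hfam : ∀ (x : Site (F.P K) 0) (μ : Fin (F.P K).d), ∑ c ∈ s, (χ c (x.shift μ) - χ c x) ^ 2 ≤ B)
    (X : PBond (F.P K) 0 → Matrix (Fin 2) (Fin 2) ℂ) :
    ∑ c ∈ s, ‖DstarL2 F n K c₀ W (toL2 F K c₀ (fun b => χ c b.src • X b))
        - toL2S F K c₀ (fun x => χ c x • (toL2S F K c₀).symm (DstarL2 F n K c₀ W (toL2 F K c₀ X)) x)‖ ^ 2
      ≤ 3 * B * (eta F n K)⁻¹ ^ 2 * ‖toL2 F K c₀ X‖ ^ 2 := by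
  have hc : 0 < c₀ := Fact.out
  -- read each difference back on the sites
  have hvec : ∀ c, ∃ g : Site (F.P K) 0 → Matrix (Fin 2) (Fin 2) ℂ,
      (∀ x, g x = (eta F n K)⁻¹ • ∑ μ : Fin (F.P K).d, (χ c (x.unshift μ) - χ c x) • R (bgUnits F K W ⟨x.unshift μ, μ⟩)⁻¹ (X ⟨x.unshift μ, μ⟩)) ∧
      DstarL2 F n K c₀ W (toL2 F K c₀ (fun b => χ c b.src • X b))
          - toL2S F K c₀ (fun x => χ c x • (toL2S F K c₀).symm (DstarL2 F n K c₀ W (toL2 F K c₀ X)) x) = toL2S F K c₀ g := by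
    intro c
    refine ⟨(toL2S F K c₀).symm (DstarL2 F n K c₀ W (toL2 F K c₀ (fun b => χ c b.src • X b))
      - toL2S F K c₀ (fun x => χ c x • (toL2S F K c₀).symm (DstarL2 F n K c₀ W (toL2 F K c₀ X)) x)), fun x => ?_,
      ((toL2S F K c₀).apply_symm_apply _).symm⟩
    rw [map_sub, Pi.sub_apply, LinearEquiv.symm_apply_apply]
    exact toL2S_symm_DstarL2_srcMul_sub_apply F (n := n) (c₀ := c₀) W (χ c) X x
  choose g hgx hback using hvec
  -- sitewise, summed over the family: `Σ_c hs(g_c x) ≤ η⁻²·3B·Σ_μ hs(X b_μ)`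
  have hsite : ∀ x, ∑ c ∈ s, ∑ j : Fin 2, ∑ k : Fin 2, ‖g c x j k‖ ^ 2
      ≤ (eta F n K)⁻¹ ^ 2 * (3 * B * ∑ μ : Fin (F.P K).d, ∑ j : Fin 2, ∑ k : Fin 2, ‖X ⟨x.unshift μ, μ⟩ j k‖ ^ 2) := by
    intro x
    have hR : ∀ μ : Fin (F.P K).d, ∑ j : Fin 2, ∑ k : Fin 2, ‖(R (bgUnits F K W ⟨x.unshift μ, μ⟩)⁻¹ (X ⟨x.unshift μ, μ⟩)) j k‖ ^ 2
        = ∑ j : Fin 2, ∑ k : Fin 2, ‖X ⟨x.unshift μ, μ⟩ j k‖ ^ 2 := fun μ =>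
      sum_norm_sq_R (inv_mem_unitary (coe_bgUnits_mem_unitary' F K W ⟨x.unshift μ, μ⟩)) _
    have hterm : ∀ c ∈ s, ∑ j : Fin 2, ∑ k : Fin 2, ‖g c x j k‖ ^ 2
        ≤ (eta F n K)⁻¹ ^ 2 * ((∑ μ : Fin (F.P K).d, (χ c (x.unshift μ) - χ c x) ^ 2) * ∑ μ : Fin (F.P K).d, ∑ j : Fin 2, ∑ k : Fin 2, ‖X ⟨x.unshift μ, μ⟩ j k‖ ^ 2) := by
      intro c _
      rw [hgx c x, hs_smul]
      refine mul_le_mul_of_nonneg_left ?_ (by positivity)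
      have h := normSq_sum_smul_le_sq Finset.univ (fun μ : Fin (F.P K).d => χ c (x.unshift μ) - χ c x)
        (fun μ => R (bgUnits F K W ⟨x.unshift μ, μ⟩)⁻¹ (X ⟨x.unshift μ, μ⟩))
      rw [Finset.sum_congr rfl fun μ _ => hR μ] at h
      exact h
    -- the family row at `x − e_μ` along `μ`
    have hw : ∑ c ∈ s, ∑ μ : Fin (F.P K).d, (χ c (x.unshift μ) - χ c x) ^ 2 ≤ 3 * B := by
      rw [Finset.sum_comm]
      have hd3 : (Fintype.card (Fin (F.P K).d) : ℝ) = 3 := by rw [Fintype.card_fin]; exact_mod_cast T3Family.P_d F K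
      calc ∑ μ : Fin (F.P K).d, ∑ c ∈ s, (χ c (x.unshift μ) - χ c x) ^ 2 ≤ ∑ _μ : Fin (F.P K).d, B :=
            Finset.sum_le_sum fun μ _ => by
              have h := hfam (x.unshift μ) μ
              rw [shift_unshift] at h
              refine le_of_eq_of_le (Finset.sum_congr rfl fun c _ => ?_) h
              rw [← neg_sub, neg_sq]
        _ = 3 * B := by rw [Finset.sum_const, Finset.card_univ, nsmul_eq_mul, hd3]
    have hX0 : 0 ≤ ∑ μ : Fin (F.P K).d, ∑ j : Fin 2, ∑ k : Fin 2, ‖X ⟨x.unshift μ, μ⟩ j k‖ ^ 2 :=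
      Finset.sum_nonneg fun _ _ => Finset.sum_nonneg fun _ _ => Finset.sum_nonneg fun _ _ => sq_nonneg _
    refine (Finset.sum_le_sum hterm).trans ?_
    rw [← Finset.mul_sum, ← Finset.sum_mul]
    exact mul_le_mul_of_nonneg_left (mul_le_mul_of_nonneg_right hw hX0) (by positivity)
  have hsumb : ∑ x : Site (F.P K) 0, ∑ μ : Fin (F.P K).d, ∑ j : Fin 2, ∑ k : Fin 2, ‖X ⟨x.unshift μ, μ⟩ j k‖ ^ 2
      = ∑ b : PBond (F.P K) 0, ∑ j : Fin 2, ∑ k : Fin 2, ‖X b j k‖ ^ 2 :=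
    sum_unshift_eq_sum_bond F (fun b => ∑ j : Fin 2, ∑ k : Fin 2, ‖X b j k‖ ^ 2)
  -- assemble
  have h1 : ∑ c ∈ s, ‖DstarL2 F n K c₀ W (toL2 F K c₀ (fun b => χ c b.src • X b))
        - toL2S F K c₀ (fun x => χ c x • (toL2S F K c₀).symm (DstarL2 F n K c₀ W (toL2 F K c₀ X)) x)‖ ^ 2
      = c₀ * ∑ x : Site (F.P K) 0, ∑ c ∈ s, ∑ j : Fin 2, ∑ k : Fin 2, ‖g c x j k‖ ^ 2 := by
    rw [Finset.sum_comm, Finset.mul_sum]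
    refine Finset.sum_congr rfl fun c _ => ?_
    rw [hback c]; exact norm_sq_toL2S (g c)
  have h2 : ∑ x : Site (F.P K) 0, ∑ c ∈ s, ∑ j : Fin 2, ∑ k : Fin 2, ‖g c x j k‖ ^ 2
      ≤ (eta F n K)⁻¹ ^ 2 * ∑ x : Site (F.P K) 0, (3 * B * ∑ μ : Fin (F.P K).d, ∑ j : Fin 2, ∑ k : Fin 2, ‖X ⟨x.unshift μ, μ⟩ j k‖ ^ 2) := by
    refine (Finset.sum_le_sum fun x _ => hsite x).trans (le_of_eq ?_)
    rw [Finset.mul_sum]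
  have h3 : ∑ x : Site (F.P K) 0, (3 * B * ∑ μ : Fin (F.P K).d, ∑ j : Fin 2, ∑ k : Fin 2, ‖X ⟨x.unshift μ, μ⟩ j k‖ ^ 2)
      ≤ 3 * B * ∑ b : PBond (F.P K) 0, ∑ j : Fin 2, ∑ k : Fin 2, ‖X b j k‖ ^ 2 := by
    rw [← Finset.mul_sum, hsumb]
  have h4 : ‖toL2 F K c₀ X‖ ^ 2 = c₀ * ∑ b : PBond (F.P K) 0, ∑ j : Fin 2, ∑ k : Fin 2, ‖X b j k‖ ^ 2 := norm_sq_toL2 X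
  rw [h4]
  exact chain_le_of_rows' hc.le (by positivity) h1 h2 h3

/-! ## §3 Operator form for families with the (Z2) readings -/

/-- ★★★ **THE FAMILY ROWS FOR ANY OPERATOR FAMILIES WITH THE (Z2) READINGS** of a family `χ_c` with per-step family row `B`:
`Σ_c ‖D_W(Zs_c φ) − Zb_c(D_W φ)‖² ≤ 3Bη⁻²‖φ‖²` and `Σ_c ‖D*_W(Zb_c f) − Zs_c(D*_W f)‖² ≤ 3Bη⁻²‖f‖²`. [cite: Balaban1985BackgroundPropagators, (3.3) p.391, (3.8) p.392, (3.100) pp.413-414] -/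
theorem sum_normSq_comm_rows_of_readings (W : GaugeField (F.P K) 0 (Matrix.specialUnitaryGroup (Fin 2) ℂ)) (χ : ι → Site (F.P K) 0 → ℝ) {B : ℝ}
    (hfam : ∀ (x : Site (F.P K) 0) (μ : Fin (F.P K).d), ∑ c ∈ s, (χ c (x.shift μ) - χ c x) ^ 2 ≤ B)
    (Zs : ι → (SiteL2K ℂ 3 (periodsT3 F K) c₀ W₂ →ₗ[ℂ] SiteL2K ℂ 3 (periodsT3 F K) c₀ W₂))
    (Zb : ι → (BondL2K ℂ 3 (periodsT3 F K) c₀ W₂ →ₗ[ℂ] BondL2K ℂ 3 (periodsT3 F K) c₀ W₂))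
    (hZs : ∀ c φ x, (toL2S F K c₀).symm (Zs c φ) x = χ c x • (toL2S F K c₀).symm φ x)
    (hZb : ∀ c f b, (toL2 F K c₀).symm (Zb c f) b = χ c b.src • (toL2 F K c₀).symm f b) :
    (∀ φ, ∑ c ∈ s, ‖DL2 F n K c₀ W (Zs c φ) - Zb c (DL2 F n K c₀ W φ)‖ ^ 2 ≤ 3 * B * (eta F n K)⁻¹ ^ 2 * ‖φ‖ ^ 2) ∧
    (∀ f, ∑ c ∈ s, ‖DstarL2 F n K c₀ W (Zb c f) - Zs c (DstarL2 F n K c₀ W f)‖ ^ 2 ≤ 3 * B * (eta F n K)⁻¹ ^ 2 * ‖f‖ ^ 2) := by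
  have eS : ∀ c φ, Zs c φ = toL2S F K c₀ (fun x => χ c x • (toL2S F K c₀).symm φ x) := fun c φ => by
    apply (toL2S F K c₀).symm.injective
    rw [LinearEquiv.symm_apply_apply]; funext x; exact hZs c φ x
  have eB : ∀ c f, Zb c f = toL2 F K c₀ (fun b => χ c b.src • (toL2 F K c₀).symm f b) := fun c f => by
    apply (toL2 F K c₀).symm.injective
    rw [LinearEquiv.symm_apply_apply]; funext b; exact hZb c f b
  refine ⟨fun φ => ?_, fun f => ?_⟩
  · obtain ⟨l, rfl⟩ : ∃ l, φ = toL2S F K c₀ l := ⟨(toL2S F K c₀).symm φ, ((toL2S F K c₀).apply_symm_apply φ).symm⟩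
    have e1 : ∀ c, Zs c (toL2S F K c₀ l) = toL2S F K c₀ (fun x => χ c x • l x) := fun c => by
      rw [eS]; congr 1; funext x; rw [LinearEquiv.symm_apply_apply]
    rw [Finset.sum_congr rfl fun c _ => by rw [e1, eB]]
    exact sum_normSq_DL2_siteMul_sub_le F s W χ hfam l
  · obtain ⟨X, rfl⟩ : ∃ X, f = toL2 F K c₀ X := ⟨(toL2 F K c₀).symm f, ((toL2 F K c₀).apply_symm_apply f).symm⟩
    have e1 : ∀ c, Zb c (toL2 F K c₀ X) = toL2 F K c₀ (fun b => χ c b.src • X b) := fun c => by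
      rw [eB]; congr 1; funext b; rw [LinearEquiv.symm_apply_apply]
    rw [Finset.sum_congr rfl fun c _ => by rw [e1, eS]]
    exact sum_normSq_DstarL2_srcMul_sub_le F s W χ hfam X

end Member

/-! ## §4 At the (χ)-dock's letters: w5's `hKD` with `κD² = 8640∕L^{2s}` -/

section Dock

variable (F : T3Family) {n K : ℕ} {c₀ : ℝ} [Fact (0 < c₀)]

/-- the family row over ALL sites equals the row over the centre set (zero weights off `Zc`). [cite: Balaban1985BackgroundPropagators, (3.100) pp.413-414] -/
theorem sum_sq_sub_univ_le {Zc : Finset (Site (F.P K) 0)} {χ : Site (F.P K) 0 → Site (F.P K) 0 → ℝ} {B : ℝ}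
    (hoff : ∀ c, c ∉ Zc → ∀ x, χ c x = 0)
    (hfam : ∀ (x : Site (F.P K) 0) (μ : Fin 3), ∑ c ∈ Zc, (χ c (x.shift μ) - χ c x) ^ 2 ≤ B)
    (x : Site (F.P K) 0) (μ : Fin (F.P K).d) : ∑ c : Site (F.P K) 0, (χ c (x.shift μ) - χ c x) ^ 2 ≤ B := by
  have h : ∑ c : Site (F.P K) 0, (χ c (x.shift μ) - χ c x) ^ 2 = ∑ c ∈ Zc, (χ c (x.shift μ) - χ c x) ^ 2 := by
    symm
    exact Finset.sum_subset (Finset.subset_univ Zc) fun c _ hc => by rw [hoff c hc, hoff c hc, sub_self, zero_pow two_ne_zero]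
  rw [h]; exact hfam x μ

/-- ★ the currency: `3·(2880∕(L^sL^{K−n})²)·η⁻² = 8640·((L^s)²)⁻¹` (`η·L^{K−n} = 1`). [cite: Balaban1985BackgroundPropagators, (3.100) pp.413-414] -/
theorem three_mul_fam_mul_inv_eta_sq (s : ℕ) :
    3 * (2880 / ((F.L : ℝ) ^ s * (F.L : ℝ) ^ (K - n)) ^ 2) * (eta F n K)⁻¹ ^ 2 = 8640 * (((F.L : ℝ) ^ s) ^ 2)⁻¹ := by
  have hL : (0 : ℝ) < F.L := by have := F.hL.2; exact_mod_cast (by omega : 0 < F.L)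
  have hη : (eta F n K)⁻¹ = (F.L : ℝ) ^ (K - n) := by rw [T3SectALandauChart.eta, ← inv_pow, inv_inv]
  have hLs : (F.L : ℝ) ^ s ≠ 0 := by positivity
  have hLK : (F.L : ℝ) ^ (K - n) ≠ 0 := by positivity
  rw [hη, mul_pow]
  field_simp
  norm_num

/-- ★★★ **w5's `hKD` AT THE DOCK**: for families `M c`, `N₂ c` (`c : Site (F.P K) 0`) with the readings of ✓`Prop7LODCutoffDock.exists_LOD_cutoffs` by a partition `χ` that vanishes
off `Zc` and has the family per-step row `2880∕(L^sL^{K−n})²` on `Zc`: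
`Σ_{c : Site} ‖D*_W(M c f) − N₂ c (D*_W f)‖² ≤ 8640·((L^s)²)⁻¹·‖f‖²` — every background `W`, K- and volume-free. [cite: Balaban1985BackgroundPropagators, (3.8) p.392, (3.100) pp.413-414] -/
theorem sum_normSq_Dstar_comm_le_of_dock {s : ℕ} {Zc : Finset (Site (F.P K) 0)} {χ : Site (F.P K) 0 → Site (F.P K) 0 → ℝ}
    (hoff : ∀ c, c ∉ Zc → ∀ x, χ c x = 0)
    (hfam : ∀ (x : Site (F.P K) 0) (μ : Fin 3), ∑ c ∈ Zc, (χ c (x.shift μ) - χ c x) ^ 2 ≤ 2880 / ((F.L : ℝ) ^ s * (F.L : ℝ) ^ (K - n)) ^ 2 ∧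
      ∑ c ∈ Zc, (χ c (x.unshift μ) - χ c x) ^ 2 ≤ 2880 / ((F.L : ℝ) ^ s * (F.L : ℝ) ^ (K - n)) ^ 2)
    (M : Site (F.P K) 0 → (BondL2K ℂ 3 (periodsT3 F K) c₀ W₂ →ₗ[ℂ] BondL2K ℂ 3 (periodsT3 F K) c₀ W₂))
    (N₂ : Site (F.P K) 0 → (SiteL2K ℂ 3 (periodsT3 F K) c₀ W₂ →ₗ[ℂ] SiteL2K ℂ 3 (periodsT3 F K) c₀ W₂))
    (hM : ∀ c f b, (toL2 F K c₀).symm (M c f) b = χ c b.src • (toL2 F K c₀).symm f b)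
    (hN₂ : ∀ c φ x, (toL2S F K c₀).symm (N₂ c φ) x = χ c x • (toL2S F K c₀).symm φ x)
    (W : GaugeField (F.P K) 0 (Matrix.specialUnitaryGroup (Fin 2) ℂ)) (f : BondL2K ℂ 3 (periodsT3 F K) c₀ W₂) :
    ∑ c : Site (F.P K) 0, ‖DstarL2 F n K c₀ W (M c f) - N₂ c (DstarL2 F n K c₀ W f)‖ ^ 2 ≤ 8640 * (((F.L : ℝ) ^ s) ^ 2)⁻¹ * ‖f‖ ^ 2 := by
  have hfam' := sum_sq_sub_univ_le F hoff (fun x μ => (hfam x μ).1)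
  have h := (sum_normSq_comm_rows_of_readings F (n := n) Finset.univ W χ hfam' N₂ M hN₂ hM).2 f
  rw [three_mul_fam_mul_inv_eta_sq] at h
  exact h

/-- ★★★ The `D`-twin: `Σ_{c : Site} ‖D_W(N₂ c φ) − M c (D_W φ)‖² ≤ 8640·((L^s)²)⁻¹·‖φ‖²`. [cite: Balaban1985BackgroundPropagators, (3.3) p.391, (3.100) pp.413-414] -/
theorem sum_normSq_D_comm_le_of_dock {s : ℕ} {Zc : Finset (Site (F.P K) 0)} {χ : Site (F.P K) 0 → Site (F.P K) 0 → ℝ}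
    (hoff : ∀ c, c ∉ Zc → ∀ x, χ c x = 0)
    (hfam : ∀ (x : Site (F.P K) 0) (μ : Fin 3), ∑ c ∈ Zc, (χ c (x.shift μ) - χ c x) ^ 2 ≤ 2880 / ((F.L : ℝ) ^ s * (F.L : ℝ) ^ (K - n)) ^ 2 ∧
      ∑ c ∈ Zc, (χ c (x.unshift μ) - χ c x) ^ 2 ≤ 2880 / ((F.L : ℝ) ^ s * (F.L : ℝ) ^ (K - n)) ^ 2)
    (M : Site (F.P K) 0 → (BondL2K ℂ 3 (periodsT3 F K) c₀ W₂ →ₗ[ℂ] BondL2K ℂ 3 (periodsT3 F K) c₀ W₂))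
    (N₂ : Site (F.P K) 0 → (SiteL2K ℂ 3 (periodsT3 F K) c₀ W₂ →ₗ[ℂ] SiteL2K ℂ 3 (periodsT3 F K) c₀ W₂))
    (hM : ∀ c f b, (toL2 F K c₀).symm (M c f) b = χ c b.src • (toL2 F K c₀).symm f b)
    (hN₂ : ∀ c φ x, (toL2S F K c₀).symm (N₂ c φ) x = χ c x • (toL2S F K c₀).symm φ x)
    (W : GaugeField (F.P K) 0 (Matrix.specialUnitaryGroup (Fin 2) ℂ)) (φ : SiteL2K ℂ 3 (periodsT3 F K) c₀ W₂) :
    ∑ c : Site (F.P K) 0, ‖DL2 F n K c₀ W (N₂ c φ) - M c (DL2 F n K c₀ W φ)‖ ^ 2 ≤ 8640 * (((F.L : ℝ) ^ s) ^ 2)⁻¹ * ‖φ‖ ^ 2 := by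
  have hfam' := sum_sq_sub_univ_le F hoff (fun x μ => (hfam x μ).1)
  have h := (sum_normSq_comm_rows_of_readings F (n := n) Finset.univ W χ hfam' N₂ M hN₂ hM).1 φ
  rw [three_mul_fam_mul_inv_eta_sq] at h
  exact h

end Dock

end Summit.QuantumFields.YangMills.Theorems.Prop7CutoffCommutatorFamily

end
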